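import Summits.HodgeConjecture.HodgeConjecture.Theses.PadicSemiregularLift
import Summits.HodgeConjecture.HodgeConjecture.Theses.TropicalCuspLift
import Summits.HodgeConjecture.HodgeConjecture.Theses.HeckePrymWeil
import Summits.HodgeConjecture.HodgeConjecture.Theorems.PadicSemiregularLiftHodgeAbelianVarietiesStubSplitSixfolds
import Summits.HodgeConjecture.HodgeConjecture.Theorems.PadicSemiregularLiftHodgeAbelianVarietiesStubDescendPrym
import Literature.AlgebraicGeometry.HodgeTheory.WeilClasses
import Literature.AlgebraicGeometry.HodgeTheory.WeilClassesFourfolds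

/-!
# Crux `HodgeAbelianVarieties` (stmt-HodgeConjecture-1333), line `prym-canonical-z3-split-seeds` — stub `stub_weilSectorOffReach`: the honest decomposition of the parked complement edge

The registered stub (skeleton `Cruxes/HodgeAbelianVarieties/Lines/prym_canonical_z3_split_seeds.lean`)
`stub_weilSectorOffReach : WeilSectorOffReach`, where
`WeilSectorOffReach := WeilAlgebraicAll 3 3 → Stubs.WeilAlgebraicSplitHyperplane 4 3 → TropicalCuspLift.WeilClassesAlgebraic`,
is the PARKED COMPLEMENT EDGE of the line: the whole imaginary-quadratic Weil sector
(stmt-HodgeConjecture-2522: the rational `(n,n)`-classes of the Weil plane of every `(A²ⁿ, φ)`,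
`φ ≫ φ = -d`, are algebraic, all `n ≥ 2`, all `K = ℚ(√-d)`) GIVEN the two `ℚ(√-3)` statements the line
proves (every Weil sixfold for `d = 3`; the split eightfolds for `d = 3`). It is OPEN, HC-implied, and is
NOT proved here. This file lands, sorry-free, with NO new definition and NO named fact, its honest
DECOMPOSITION into the tree's typed statements, using that DESCENDING is now a THEOREM of the tree
(`PrymCanonicalZ3SplitSeeds.Stubs.Descend.stub_descend`, all `n ≥ 2`, `d ≥ 1`: split `2(n+1)`-folds give
every Weil-type `2n`-fold — Schoen 1998 §10, Markman arXiv:2509.23403 §11.5 Step 2).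

* Dictionaries: `weilClassesAlgebraic_iff_weilAlgebraicAll` (the target IS
  `∀ n ≥ 2, ∀ d ≥ 1, WeilAlgebraicAll n d`: `mem_weilClassesOf_iff`, and smooth projectivity of abelian
  varieties is a theorem), `weilSixfolds_iff_weilAlgebraicAll_three` (stmt-HodgeConjecture-2524 is its row
  `n = 3`), `weilAlgebraicAll_two_iff_markman` (its row `n = 2`, all `d`, IS the tree's named fact
  `Markman2025_weilClasses_algebraic_abelianFourfold`, Markman arXiv:2509.23403 Thm. 1.2: KNOWN),
  `weilClassesOf_le_eigenspace_sup` (Weil plane `≤` the `(𝟙 + φ)^*`-eigenspace typing of route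
  `HeckePrymWeil`).
* `weilClassesAlgebraic_iff_cells` (REGISTERED helper) — **THE DECOMPOSITION, an `iff`**:
  `WeilClassesAlgebraic ↔ (∀ d, 0 < d → WeilAlgebraicAll 2 d) ∧ WeilAlgebraicAll 3 3 ∧ R` with the RESIDUAL
  `R := ∀ n d, 4 ≤ n → 0 < d → (n ≠ 4 ∨ d ≠ 3) → Stubs.WeilAlgebraicSplitHyperplane n d`,
  the split sector (hyperplane convention) in half-dimension `n ≥ 4` OFF the line's one cell `(4, 3)`:
  by Descending the cell `(n, d)`, `n ≥ 3`, of the target is fed by the split cell `(n + 1, d)`, and the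
  cell `(3, 3)` is the hypothesis `WeilAlgebraicAll 3 3` itself — so the residual is VISIBLY the cells
  "`n = 3 ∧ d ≠ 3`, or `n ≥ 4`" of `WeilClassesAlgebraic`, i.e. "`d ≠ 3` or `n ≥ 4`" beyond the fourfolds.
  (The edge's second hypothesis `Stubs.WeilAlgebraicSplitHyperplane 4 3` serves the target only through
  `WeilAlgebraicAll 3 3 = Descend.descend_three_three _`, hence is idle once the first is granted.)
* `weilSectorOffReach_of_markman_of_residual` (REGISTERED helper) — hence, modulo the KNOWN fourfold fact,
  **the parked edge is exactly `R`**: the e-step line's E-tower `stub_eTower` minus the cell `(4, 3)` (dead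
  as a mechanism, alive as a statement: `Lines/e-step-secant-induction-dead.md`); `R` is itself a fragment
  of the target (`splitHyperplane_of_weilClassesAlgebraic`), so nothing weaker can replace it.
* `weilClassesAlgebraic_cells_le_three_of` (REGISTERED helper) — the SHARPER use of the `d = 3` data: the
  cells `d = 3`, `n ∈ {2, 3}` of `WeilClassesAlgebraic`, in the route's literal binder shape
  (`∃ c₁ c₂, …` eigen-decomposition), from the fourfold fact and `WeilAlgebraicAll 3 3` ALONE.
* Where the other Weil routes plug into `R`: its row `n = 4` off `d = 3` gives, with `WeilAlgebraicAll 3 3`,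
  the typed open crux `TropicalCuspLift.WeilSixfolds` (stmt-HodgeConjecture-2524;
  `weilSixfolds_of_three_three_of_splitEightfolds_off`), and its cell `(4, 7)` IS IMPLIED BY the typed open
  crux `HeckePrymWeil.HyperbolicEightfoldsSqrtMinus7` (stmt-HodgeConjecture-14642;
  `splitHyperplane_four_seven_of_hyperbolicEightfoldsSqrtMinus7`).
* `weilClassesAlgebraic_of_eStep`, `weilSixfolds_of_eStep` (REGISTERED by the e-step line, gen 3; not landed
  before) and the discharged form `weilClassesAlgebraic_of_markman_of_eTower` (REGISTERED helper): the whole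
  sector from Markman's Theorem 1.5.1 (`Markman2025_weilClasses_algebraic_hyperbolicSixfold`: split
  sixfolds, all `d`) and the full E-tower `∀ n ≥ 4, ∀ d ≥ 1, Stubs.WeilAlgebraicSplitHyperplane n d` — TWO
  hypotheses, the row `n = 2` needing no separate input once Descending is a theorem;
  `weilSectorOffReach_of_eTower_of_descend` (REGISTERED helper) is the hypothesis-form corollary.
* Upper bound: every cell of `R` is an instance of the crux (`splitHyperplane_of_hodgeAbelianVarieties`).

Named open statements the edge reduces to: `R`, i.e. every cell `Stubs.WeilAlgebraicSplitHyperplane n d`,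
`n ≥ 4`, `d ≥ 1`, `(n, d) ≠ (4, 3)` (nothing in print for any `K` in dimension `≥ 8`, Markman
arXiv:2502.03415 §1.2); typed names meeting it: `TropicalCuspLift.WeilSixfolds` (row `n = 4` after
Descending), `HeckePrymWeil.HyperbolicEightfoldsSqrtMinus7` (cell `(4, 7)`). Not attempted: any cell of `R`.
-/

-- every declaration of this problem lives in `Summit.HodgeConjecture.HodgeConjecture.…` (single-problem summit)
set_option linter.dupNamespace false

noncomputable section

open CategoryTheory
open Literature.AlgebraicGeometry Literature.AlgebraicGeometry.Motives
  Literature.AlgebraicGeometry.HodgeTheory Literature.AlgebraicTopology.SingularHomology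

namespace Summit.HodgeConjecture.HodgeConjecture.Cruxes.HodgeAbelianVarieties.PrymCanonicalZ3SplitSeeds.Stubs.WeilSectorOffReach

open Summit.HodgeConjecture.HodgeConjecture.Cruxes.HodgeAbelianVarieties.EStepSecantInduction

/-! ### Dictionaries: the route targets in the line's vocabulary -/

/-- **`TropicalCuspLift.WeilClassesAlgebraic ↔ ∀ n ≥ 2, ∀ d ≥ 1, WeilAlgebraicAll n d`**: the item's
inline eigen-decomposition `c = c₁ + c₂` is membership in `weilClassesOf A φ n d`
(`mem_weilClassesOf_iff`), and its hypothesis `IsSmoothProjective (2n) A.X` is a theorem for abelian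
varieties (`isSmoothProjective_of_dim_eq'`). [cite: vanGeemen1994HodgeAV, 4.9 and proof of Thm. 6.12] -/
theorem weilClassesAlgebraic_iff_weilAlgebraicAll :
    Summit.HodgeConjecture.HodgeConjecture.Theses.TropicalCuspLift.WeilClassesAlgebraic ↔
      ∀ n d : ℕ, 2 ≤ n → 0 < d → WeilAlgebraicAll n d := by
  constructor
  · intro h n d hn hd A φ hA hφ c hw hc hH
    exact h n hn d hd A φ hA (isSmoothProjective_of_dim_eq' hA) hφ c hc hH
      (mem_weilClassesOf_iff.1 hw)
  · intro h n hn d hd A φ hA _ hφ c hc hH hw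
    exact h n d hn hd A φ hA hφ c (mem_weilClassesOf_iff.2 hw) hc hH

/-- **`TropicalCuspLift.WeilSixfolds ↔ ∀ d ≥ 1, WeilAlgebraicAll 3 d`** (stmt-HodgeConjecture-2524 is the
row `n = 3` of the target), same dictionary. [cite: vanGeemen1994HodgeAV, 4.9 and proof of Thm. 6.12] -/
theorem weilSixfolds_iff_weilAlgebraicAll_three :
    Summit.HodgeConjecture.HodgeConjecture.Theses.TropicalCuspLift.WeilSixfolds ↔
      ∀ d : ℕ, 0 < d → WeilAlgebraicAll 3 d := by
  constructor
  · intro h d hd A φ hA hφ c hw hc hH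
    exact h d hd A φ hA (isSmoothProjective_of_dim_eq' hA) hφ c hc hH (mem_weilClassesOf_iff.1 hw)
  · intro h d hd A φ hA _ hφ c hc hH hw
    exact h d hd A φ hA hφ c (mem_weilClassesOf_iff.2 hw) hc hH

/-- **The row `n = 2`, all `d`, IS the fourfold fact** `Markman2025_weilClasses_algebraic_abelianFourfold`
(Markman, arXiv:2509.23403 Thm. 1.2: Weil classes on abelian fourfolds of Weil type are algebraic for
every `K` and every discriminant — KNOWN). [cite: Markman2025SurveySecant, Thm. 1.2 and §11.5 Step 2] -/
theorem weilAlgebraicAll_two_iff_markman :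
    (∀ d : ℕ, 0 < d → WeilAlgebraicAll 2 d) ↔ Markman2025_weilClasses_algebraic_abelianFourfold := by
  constructor
  · intro h d hd A φ hA _ hφ c hc hH hw
    exact h d hd A φ hA hφ c hw hc hH
  · intro h d hd A φ hA hφ c hw hc hH
    exact h d hd A φ hA (isSmoothProjective_of_dim_eq' hA) hφ c hc hH hw

/-- The split sector (hyperplane convention) is a sub-case of the full sector. [folklore] -/
theorem splitHyperplane_of_weilAlgebraicAll {n d : ℕ} (h : WeilAlgebraicAll n d) :
    Stubs.WeilAlgebraicSplitHyperplane n d :=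
  fun A φ _ _ hA hφ _ _ _ => h A φ hA hφ

/-- The Weil plane `E₊ ⊔ E₋` (joint eigen-conditions of ALL `(x·𝟙 + y·φ)^*`, `x y : ℕ`) lies in the sum
of the two eigenspaces of the single test endomorphism `(𝟙 + φ)^*` for `(1 ± i√d)²ⁿ` — the typing of
route `HeckePrymWeil` (specialise at `(x, y) = (1, 1)`). [cite: vanGeemen1994HodgeAV, 4.9] -/
theorem weilClassesOf_le_eigenspace_sup {A : AbelianVariety ℂ} (φ : A ⟶ A) (n d : ℕ) :
    weilClassesOf A φ n d ≤
      Module.End.eigenspace (complexBetti.map (𝟙 A + φ).hom.hom.hom (2 * n)).hom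
          ((1 + Complex.I * (Real.sqrt (d : ℝ) : ℂ)) ^ (2 * n)) ⊔
        Module.End.eigenspace (complexBetti.map (𝟙 A + φ).hom.hom.hom (2 * n)).hom
          ((1 - Complex.I * (Real.sqrt (d : ℝ) : ℂ)) ^ (2 * n)) := by
  refine sup_le_sup (fun c hc => ?_) (fun c hc => ?_)
  · have h := (mem_weilClassesPlus_iff.1 hc) 1 1
    simp only [one_smul, Nat.cast_one, one_mul] at h
    rw [Module.End.mem_eigenspace_iff]
    exact h
  · have h := (mem_weilClassesMinus_iff.1 hc) 1 1
    simp only [one_smul, Nat.cast_one, one_mul] at h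
    rw [Module.End.mem_eigenspace_iff]
    exact h

/-! ### The decomposition of the target and of the edge -/

/-- **THE DECOMPOSITION (registered helper `weilClassesAlgebraic_iff_cells`)**: the imaginary-quadratic
Weil sector is EQUIVALENT to the conjunction of its row `n = 2` (all `d`; KNOWN, Markman), its cell
`(n, d) = (3, 3)` (`WeilAlgebraicAll 3 3`, this line's target), and the RESIDUAL: the split sector in
half-dimension `n ≥ 4` off the one cell `(4, 3)`. `→`: every conjunct is a fragment of the sector.
`←`: the cell `(n, d)`, `n ≥ 3`, `(n, d) ≠ (3, 3)`, is DESCENDING (`Stubs.Descend.stub_descend`, a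
theorem) applied to the split cell `(n + 1, d) ≠ (4, 3)`.
[cite: Schoen1998HodgeWeilAddendum, §10 (Proposition and proof, pp. 332–333)]
[cite: Markman2025SurveySecant, §11.5 Step 2] -/
theorem weilClassesAlgebraic_iff_cells :
    Summit.HodgeConjecture.HodgeConjecture.Theses.TropicalCuspLift.WeilClassesAlgebraic ↔
      (∀ d : ℕ, 0 < d → WeilAlgebraicAll 2 d) ∧ WeilAlgebraicAll 3 3 ∧
        ∀ n d : ℕ, 4 ≤ n → 0 < d → (n ≠ 4 ∨ d ≠ 3) → Stubs.WeilAlgebraicSplitHyperplane n d := by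
  rw [weilClassesAlgebraic_iff_weilAlgebraicAll]
  refine ⟨fun h => ⟨fun d hd => h 2 d le_rfl hd, h 3 3 (by norm_num) (by norm_num),
    fun n d hn hd _ => splitHyperplane_of_weilAlgebraicAll (h n d (by omega) hd)⟩, ?_⟩
  rintro ⟨h2, h33, hR⟩ n d hn hd
  rcases Nat.lt_or_ge n 3 with hn3 | hn3
  · obtain rfl : n = 2 := by omega
    exact h2 d hd
  rcases Nat.lt_or_ge n 4 with hn4 | hn4
  · obtain rfl : n = 3 := by omega
    by_cases hd3 : d = 3
    · subst hd3
      exact h33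
    · exact Stubs.Descend.stub_descend 3 d (by norm_num) hd (hR 4 d le_rfl hd (Or.inr hd3))
  · exact Stubs.Descend.stub_descend n d (by omega) hd (hR (n + 1) d (by omega) hd (Or.inl (by omega)))

/-- The split sector in every half-dimension `n ≥ 2` — in particular the residual — is a fragment of the
target, so the decomposition loses nothing. [folklore] -/
theorem splitHyperplane_of_weilClassesAlgebraic
    (h : Summit.HodgeConjecture.HodgeConjecture.Theses.TropicalCuspLift.WeilClassesAlgebraic)
    {n d : ℕ} (hn : 2 ≤ n) (hd : 0 < d) : Stubs.WeilAlgebraicSplitHyperplane n d :=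
  splitHyperplane_of_weilAlgebraicAll (weilClassesAlgebraic_iff_weilAlgebraicAll.1 h n d hn hd)

/-- **The parked edge, decomposed (registered helper `weilSectorOffReach_of_markman_of_residual`)**:
granted the KNOWN fourfold fact, `WeilSectorOffReach` (= `WeilAlgebraicAll 3 3 →
Stubs.WeilAlgebraicSplitHyperplane 4 3 → WeilClassesAlgebraic`) follows from — and, by
`splitHyperplane_of_weilClassesAlgebraic`, is equivalent to — the RESIDUAL alone: the split Weil sector in
half-dimension `n ≥ 4` off the cell `(4, 3)`, i.e. the cells "`d ≠ 3`, or `n ≥ 4`" of the target beyond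
the fourfolds. The hypothesis `Stubs.WeilAlgebraicSplitHyperplane 4 3` is idle: it serves the target
only through `WeilAlgebraicAll 3 3` (`Stubs.Descend.descend_three_three`).
[cite: Markman2025SurveySecant, Thm. 1.2 and §11.5 Step 2]
[cite: Schoen1998HodgeWeilAddendum, §10 (Proposition and proof, pp. 332–333)] -/
theorem weilSectorOffReach_of_markman_of_residual :
    Markman2025_weilClasses_algebraic_abelianFourfold →
      (∀ n d : ℕ, 4 ≤ n → 0 < d → (n ≠ 4 ∨ d ≠ 3) → Stubs.WeilAlgebraicSplitHyperplane n d) →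
        (WeilAlgebraicAll 3 3 → Stubs.WeilAlgebraicSplitHyperplane 4 3 →
          Summit.HodgeConjecture.HodgeConjecture.Theses.TropicalCuspLift.WeilClassesAlgebraic) :=
  fun hM hR h33 _ => weilClassesAlgebraic_iff_cells.2 ⟨weilAlgebraicAll_two_iff_markman.2 hM, h33, hR⟩

/-- **The SHARPER use of the two `d = 3` data (registered helper `weilClassesAlgebraic_cells_le_three_of`)**:
the cells `d = 3`, `2 ≤ n ≤ 3` of `TropicalCuspLift.WeilClassesAlgebraic`, in the route's literal binder
shape, follow from the fourfold fact (`n = 2`) and `WeilAlgebraicAll 3 3` (`n = 3`) ALONE — dictionary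
`mem_weilClassesOf_iff`. [cite: Markman2025SurveySecant, Thm. 1.2]
[cite: vanGeemen1994HodgeAV, 4.9 and proof of Thm. 6.12] -/
theorem weilClassesAlgebraic_cells_le_three_of :
    Markman2025_weilClasses_algebraic_abelianFourfold → WeilAlgebraicAll 3 3 →
      ∀ n : ℕ, 2 ≤ n → n ≤ 3 →
        ∀ (A : AbelianVariety ℂ) (φ : A ⟶ A), A.dim = 2 * n → IsSmoothProjective (2 * n) A.X →
          φ ≫ φ = -(3 • 𝟙 A) →
            ∀ c : singularCohomology ℂ ℂ (ComplexPoints A.X) (2 * n), IsRationalClass c →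
              IsOfHodgeType (2 * n) A.X (2 * n) n n c →
                (∃ c₁ c₂ : singularCohomology ℂ ℂ (ComplexPoints A.X) (2 * n), c = c₁ + c₂ ∧
                  (∀ x y : ℕ, singularCohomology.map ℂ ℂ
                      (AlgPoints.mapContinuous (L := ℂ) (x • 𝟙 A + y • φ).hom.hom.hom) (2 * n) c₁ =
                    ((x : ℂ) + (y : ℂ) * Complex.I * (Real.sqrt 3 : ℂ)) ^ (2 * n) • c₁) ∧
                  (∀ x y : ℕ, singularCohomology.map ℂ ℂ
                      (AlgPoints.mapContinuous (L := ℂ) (x • 𝟙 A + y • φ).hom.hom.hom) (2 * n) c₂ =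
                    ((x : ℂ) - (y : ℂ) * Complex.I * (Real.sqrt 3 : ℂ)) ^ (2 * n) • c₂)) →
                  c ∈ algebraicClasses A.X n := by
  intro hM h33 n hn hn3 A φ hA hX hφ c hc hH hw
  have hw' : c ∈ weilClassesOf A φ n 3 := mem_weilClassesOf_iff.2 hw
  rcases Nat.lt_or_ge n 3 with h | h
  · obtain rfl : n = 2 := by omega
    exact hM 3 (by norm_num) A φ hA hX hφ c hc hH hw'
  · obtain rfl : n = 3 := by omega
    exact h33 A φ hA hφ c hw' hc hH

/-! ### Where the other Weil routes meet the residual -/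

/-- **Row `n = 4` of the residual, after Descending, is `TropicalCuspLift.WeilSixfolds` off `d = 3`**
(stmt-HodgeConjecture-2524, Weil classes on abelian sixfolds, every `K`, every discriminant — OPEN off
the split components): `WeilAlgebraicAll 3 3` and the split eightfolds for every `d ≠ 3` give it.
[cite: Schoen1998HodgeWeilAddendum, §10 (Proposition and proof, pp. 332–333)] -/
theorem weilSixfolds_of_three_three_of_splitEightfolds_off (h33 : WeilAlgebraicAll 3 3)
    (hR : ∀ d : ℕ, 0 < d → d ≠ 3 → Stubs.WeilAlgebraicSplitHyperplane 4 d) :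
    Summit.HodgeConjecture.HodgeConjecture.Theses.TropicalCuspLift.WeilSixfolds := by
  refine weilSixfolds_iff_weilAlgebraicAll_three.2 fun d hd => ?_
  by_cases hd3 : d = 3
  · subst hd3
    exact h33
  · exact Stubs.Descend.stub_descend 3 d (by norm_num) hd (hR d hd hd3)

/-- **The cell `(4, 7)` of the residual is implied by the typed open crux
`HeckePrymWeil.HyperbolicEightfoldsSqrtMinus7`** (stmt-HodgeConjecture-14642: split `ℚ(√-7)` eightfolds in
the `(𝟙 + φ)^*`-eigenspace typing; the Weil plane lies in that eigenspace sum,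
`weilClassesOf_le_eigenspace_sup`, and `-(7 • 𝟙 A) = -((7 : ℤ) • 𝟙 A)`).
[cite: vanGeemen1994HodgeAV, 4.9 and Lemma 5.2] -/
theorem splitHyperplane_four_seven_of_hyperbolicEightfoldsSqrtMinus7
    (h : Summit.HodgeConjecture.HodgeConjecture.Theses.HeckePrymWeil.HyperbolicEightfoldsSqrtMinus7) :
    Stubs.WeilAlgebraicSplitHyperplane 4 7 := by
  intro A φ e a hA hφ ha ha0 hhyp c hw hc hH
  have hφ' : φ ≫ φ = -((7 : ℤ) • 𝟙 A) := by rw [hφ, ofNat_zsmul]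
  exact h A φ hA hφ' e a ha ha0 hhyp c hc hH (weilClassesOf_le_eigenspace_sup φ 4 7 hw)

/-! ### The e-step composition, importable, and its discharge by Descending -/

/-- **`weilClassesAlgebraic_of_eStep` (registered sub-goal of stmt-HodgeConjecture-1333, e-step gen 3)**:
Markman's Theorem 1.5.1 (split sixfolds, all `d`: `Markman2025_weilClasses_algebraic_hyperbolicSixfold`,
which IS `∀ d ≥ 1, Stubs.WeilAlgebraicSplitHyperplane 3 d` —
`Stubs.weilAlgebraicSplitHyperplane_three_iff_markman`), the E-tower (split, `n ≥ 4`) and Descending give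
the whole imaginary-quadratic Weil sector. [cite: Markman2025SecantWeil, Thm. 1.5.1]
[cite: Markman2025SurveySecant, §11.5 Step 2] -/
theorem weilClassesAlgebraic_of_eStep :
    Markman2025_weilClasses_algebraic_hyperbolicSixfold →
      (∀ n d : ℕ, 4 ≤ n → 0 < d → Stubs.WeilAlgebraicSplitHyperplane n d) →
        (∀ n d : ℕ, 2 ≤ n → 0 < d → Stubs.WeilAlgebraicSplitHyperplane (n + 1) d →
          WeilAlgebraicAll n d) →
          Summit.HodgeConjecture.HodgeConjecture.Theses.TropicalCuspLift.WeilClassesAlgebraic := by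
  intro hM hE hD
  rw [weilClassesAlgebraic_iff_weilAlgebraicAll]
  intro n d hn hd
  refine hD n d hn hd ?_
  rcases Nat.lt_or_ge n 3 with h | h
  · obtain rfl : n = 2 := by omega
    exact Stubs.weilAlgebraicSplitHyperplane_three_iff_markman.2 hM d hd
  · exact hE (n + 1) d (by omega) hd

/-- **The sector from TWO inputs (registered helper `weilClassesAlgebraic_of_markman_of_eTower`)**:
Descending being a theorem, `TropicalCuspLift.WeilClassesAlgebraic` follows from Markman's Theorem 1.5.1
and the E-tower `∀ n ≥ 4, ∀ d ≥ 1, Stubs.WeilAlgebraicSplitHyperplane n d` (OPEN: nothing in print for any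
`K` in dimension `≥ 8`). [cite: Markman2025SecantWeil, Thm. 1.5.1 and §1.2]
[cite: Schoen1998HodgeWeilAddendum, §10 (Proposition and proof, pp. 332–333)] -/
theorem weilClassesAlgebraic_of_markman_of_eTower :
    Markman2025_weilClasses_algebraic_hyperbolicSixfold →
      (∀ n d : ℕ, 4 ≤ n → 0 < d → Stubs.WeilAlgebraicSplitHyperplane n d) →
        Summit.HodgeConjecture.HodgeConjecture.Theses.TropicalCuspLift.WeilClassesAlgebraic :=
  fun hM hE => weilClassesAlgebraic_of_eStep hM hE Stubs.Descend.stub_descend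

/-- The hypothesis-form corollary named in the line's brief (registered helper
`weilSectorOffReach_of_eTower_of_descend`): Markman's Theorem 1.5.1, the E-tower and Descending give the
edge outright (both of its hypotheses idle) — recorded to make explicit that the sharper statement is
`weilSectorOffReach_of_markman_of_residual`. [cite: Markman2025SecantWeil, Thm. 1.5.1] -/
theorem weilSectorOffReach_of_eTower_of_descend :
    Markman2025_weilClasses_algebraic_hyperbolicSixfold →
      (∀ n d : ℕ, 4 ≤ n → 0 < d → Stubs.WeilAlgebraicSplitHyperplane n d) →
        (∀ n d : ℕ, 2 ≤ n → 0 < d → Stubs.WeilAlgebraicSplitHyperplane (n + 1) d →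
          WeilAlgebraicAll n d) →
          (WeilAlgebraicAll 3 3 → Stubs.WeilAlgebraicSplitHyperplane 4 3 →
            Summit.HodgeConjecture.HodgeConjecture.Theses.TropicalCuspLift.WeilClassesAlgebraic) :=
  fun hM hE hD _ _ => weilClassesAlgebraic_of_eStep hM hE hD

/-- **`weilSixfolds_of_eStep` (registered sub-goal of stmt-HodgeConjecture-1333, e-step gen 3)**: split
eightfolds (all `d`) and Descending at `n = 3` give `TropicalCuspLift.WeilSixfolds`; with Descending a
theorem the second hypothesis is discharged by `Stubs.Descend.stub_descend 3`.
[cite: Markman2025SurveySecant, §11.5 Step 2] -/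
theorem weilSixfolds_of_eStep :
    (∀ d : ℕ, 0 < d → Stubs.WeilAlgebraicSplitHyperplane 4 d) →
      (∀ d : ℕ, 0 < d → Stubs.WeilAlgebraicSplitHyperplane 4 d → WeilAlgebraicAll 3 d) →
        Summit.HodgeConjecture.HodgeConjecture.Theses.TropicalCuspLift.WeilSixfolds :=
  fun hE hD => weilSixfolds_iff_weilAlgebraicAll_three.2 fun d hd => hD d hd (hE d hd)

/-! ### Upper bound: the residual is an instance of the crux -/

/-- Sanity: every cell of the split sector is implied by the crux `HodgeAbelianVarieties` (Disproof §10
pattern), so the decomposition claims nothing beyond the summit restricted to abelian varieties.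
[cite: Deligne2000, §1] -/
theorem splitHyperplane_of_hodgeAbelianVarieties
    (h : Summit.HodgeConjecture.HodgeConjecture.Theses.PadicSemiregularLift.HodgeAbelianVarieties)
    (n d : ℕ) : Stubs.WeilAlgebraicSplitHyperplane n d := by
  refine splitHyperplane_of_weilAlgebraicAll fun A φ hA _ => ?_
  have hA' := h A
  rw [hA] at hA'
  exact Stubs.weilAlgebraicFor_of_hodgeConjectureFor hA'

end Summit.HodgeConjecture.HodgeConjecture.Cruxes.HodgeAbelianVarieties.PrymCanonicalZ3SplitSeeds.Stubs.WeilSectorOffReach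

end
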